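import Summits.BirchSwinnertonDyer.BirchSwinnertonDyer.Theorems.GoldfeldAllTwistsTwoConverseTwinAdditiveTwoPrimesTwistSelmerPOne
import Summits.BirchSwinnertonDyer.BirchSwinnertonDyer.Theorems.GoldfeldAllTwistsTwoConverseTwinAdditiveTwoAdicThreeModEightPFive
import HarnessLib

set_option linter.dupNamespace false -- namespace `…BirchSwinnertonDyer.BirchSwinnertonDyer…` is the cell's (D-0017 nested layout)
set_option autoImplicit false

/-!
# B5⁺ tranche F_β⁺, file Fβ⁺-2: the SHARP Selmer set `S(−42qp, 448q²p²) ⊆ {1, 7}` of `W = 49a1^{(−2qp)}` on `q ≡ 3 (8)`, `(q/7) = −1`, `p ≡ 5 (8)`,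
# **`(p/q) = +1`** (cell b35+ — and a35+: TYPE-FREE), FACT-FREE

Cell `bsd-goldfeld`, seat `bsd-goldfeld-s1p-c3x` (gen 16); planner ORDER (cccxciii) «OBJECT B5⁺», tranche F_β⁺ (kill table `scoping/kills_b35_plus.txt`,
41 rows incl. q = 3: `S(W) = {1, 7}` uniformly; the classes `p, 7p` die at `2`, `2p, 14p` at `q`, `2, 14` at `q`, the `q`-classes at `q`, negatives at `ℝ`).
TWIN of C5-F's F-S `…TwinAdditiveTwoPrimesTwistSelmerThreeModEightPOne` (`(3, 1, −)`, type β) with: `hp8 : p % 8 = 1 ↦ 5`, `hpq = −1 ↦ +1`; the kills of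
`p, 7p` moved from `q` (there `(p/q) = −1`) to `2` (Fβ⁺-0b `not_isSoluble_two_class_P_threeModEightPFive` / `…_sevenP_…`), the kills of `2p, 14p` moved from
the type-β root test at `p` to the prime `q` (`(2p/q) = (2/q)(p/q) = −1`); hence NO type binder and no `hp7`. `--supports stmt-BirchSwinnertonDyer-19140` as a
HELPER. Theses-free; theorems only; no definition, no fact binder, no `sorry`. FRONTIER-grade: a twist-density-ZERO sub-family; never distance-to-summit.
HONEST FRAMING: a Selmer bound; no `BSD(W,2)` is proved here; items 19140 / 19350 / 20044 unchanged; BSD is not proved by any of this.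

References: [SilvermanAEC2009] Prop. X.4.9, Example X.4.10; [Serre1973] Ch. II §3.3 Thm 4.
-/

noncomputable section

open scoped Classical

open WeierstrassCurve Literature.NumberTheory.EllipticCurves

namespace Summit.BirchSwinnertonDyer.BirchSwinnertonDyer.Theorems.GoldfeldGoodTwists

section SelmerSThreeFivePlus
variable {q p : ℕ} [Fact q.Prime] [Fact p.Prime]

/-- A natural number not divisible by the prime `ℓ` is non-zero in `ZMod ℓ`, as an integer cast. [folklore] -/
private theorem intCast_ne_zero_of_not_dvd_sThreeFivePlus {l : ℕ} [Fact l.Prime] {n : ℕ} (h : ¬ l ∣ n) : ((n : ℤ) : ZMod l) ≠ 0 := by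
  rw [Int.cast_natCast, Ne, ZMod.natCast_eq_zero_iff]; exact h

/-- `ℓ ∤ 2^a · 7^b` for a prime `ℓ ∉ {2, 7}`. [folklore] -/
private theorem not_dvd_two_pow_mul_seven_pow_sThreeFivePlus {l : ℕ} (hl : l.Prime) (hl2 : l ≠ 2) (hl7 : l ≠ 7) (a b : ℕ) : ¬ l ∣ 2 ^ a * 7 ^ b := by
  intro h
  rcases (Nat.Prime.dvd_mul hl).mp h with h | h
  · exact hl2 ((Nat.prime_dvd_prime_iff_eq hl Nat.prime_two).mp (hl.dvd_of_dvd_pow h))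
  · exact hl7 ((Nat.prime_dvd_prime_iff_eq hl (by norm_num)).mp (hl.dvd_of_dvd_pow h))


set_option maxHeartbeats 400000 in -- sixteen positive classes, each with its local computation
/-- **`S(−42qp, 448q²p²) ⊆ {1, 7}`** on `q ≡ 3 (8)`, `(q/7) = −1`, `p ≡ 5 (8)`, `(p/q) = +1` (cells b35+ / a35+; no type condition): negatives at `ℝ`,
the `q`-classes, `2, 14` and `2p, 14p` at `q`, `p, 7p` at `2`. [cite: SilvermanAEC2009, Prop. X.4.9 and Example X.4.10] -/
theorem twoIsogenySelmerGroup_twoPrimesTwist_subset_pair_threeModEightPlusPFive (hq8 : q % 8 = 3) (hq7 : jacobiSym q 7 = -1) (hp8 : p % 8 = 5)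
    (hpq : jacobiSym p q = 1) :
    twoIsogenySelmerGroup (-42 * ((q : ℤ) * p)) (448 * ((q : ℤ) * p) ^ 2) ⊆ ({1, 7} : Finset ℤ) := by
  have hq4 : q % 4 = 3 := by omega
  have hq : q.Prime := Fact.out
  have hp : p.Prime := Fact.out
  have hqZ : Prime (q : ℤ) := Nat.prime_iff_prime_int.mp hq
  have hpZ : Prime (p : ℤ) := Nat.prime_iff_prime_int.mp hp
  have hq0 : (q : ℤ) ≠ 0 := by exact_mod_cast hq.ne_zero
  have hp0 : (p : ℤ) ≠ 0 := by exact_mod_cast hp.ne_zero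
  have hq2 : q ≠ 2 := by rintro rfl; norm_num at hq4
  have hp2 : p ≠ 2 := by rintro rfl; norm_num at hp8
  have hqp : q ≠ p := by rintro rfl; omega
  have hq7' : q ≠ 7 := by
    rintro rfl; rw [jacobiSym.mod_left] at hq7; norm_num at hq7
  obtain ⟨h7q, hm7q⟩ := legendreSym_seven_and_neg_seven_of_three_mod_four hq4 hq7
  have h2q : legendreSym q 2 = -1 := by
    rw [legendreSym.at_two hq2, ZMod.χ₈_nat_eq_if_mod_eight]; simp [hq8, show q % 2 = 1 by omega]
  -- `(p/q) = +1` as a Legendre symbol at `q`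
  have hpq_q : legendreSym q p = 1 := by rw [jacobiSym.legendreSym.to_jacobiSym]; exact_mod_cast hpq
  -- non-vanishing modulo `q` and modulo `p`
  have hpq0 : (p : ZMod q) ≠ 0 := by
    have := intCast_ne_zero_of_not_dvd_sThreeFivePlus (l := q) (fun h ↦ hqp ((Nat.prime_dvd_prime_iff_eq hq hp).mp h)); exact_mod_cast this
  have hcq : ∀ a b : ℕ, (((2 ^ a * 7 ^ b : ℕ) : ℤ) : ZMod q) ≠ 0 := fun a b ↦
    intCast_ne_zero_of_not_dvd_sThreeFivePlus (not_dvd_two_pow_mul_seven_pow_sThreeFivePlus hq hq2 hq7' a b)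
  have h8q : ((8 : ℤ) : ZMod q) ≠ 0 := by have := hcq 3 0; norm_num at this; exact_mod_cast this
  have h4q : ((4 : ℤ) : ZMod q) ≠ 0 := by have := hcq 2 0; norm_num at this; exact_mod_cast this
  have h2pq : ((2 * p : ℤ) : ZMod q) ≠ 0 := by
    have h2 := hcq 1 0; norm_num at h2; push_cast; exact mul_ne_zero (by exact_mod_cast h2) hpq0
  -- the non-residues modulo `q`: `2, 14, 2p, 14p` (`(2/q) = −1`, `(7/q) = +1`, `(p/q) = +1`) and their co-classes
  have h4pq : ((4 * p : ℤ) : ZMod q) ≠ 0 := by push_cast; exact mul_ne_zero (by exact_mod_cast h4q) hpq0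
  have hns_2_q : ¬ IsSquare (((2 : ℤ)) : ZMod q) := (legendreSym.eq_neg_one_iff q).mp h2q
  have hns_14_q : ¬ IsSquare (((14 : ℤ)) : ZMod q) :=
    (legendreSym.eq_neg_one_iff q).mp (by rw [show (14 : ℤ) = 2 * 7 by norm_num, legendreSym.mul, h2q, h7q]; norm_num)
  have hns_224pp_q : ¬ IsSquare (((224 * p ^ 2 : ℤ)) : ZMod q) := by
    rw [show (224 * p ^ 2 : ℤ) = 14 * (4 * p) ^ 2 by ring]; exact not_isSquare_mul_sq_zmod h4pq hns_14_q
  have hns_32pp_q : ¬ IsSquare (((32 * p ^ 2 : ℤ)) : ZMod q) := by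
    rw [show (32 * p ^ 2 : ℤ) = 2 * (4 * p) ^ 2 by ring]; exact not_isSquare_mul_sq_zmod h4pq hns_2_q
  have hns_2p_q : ¬ IsSquare ((((p : ℤ) * 2 : ℤ)) : ZMod q) :=
    (legendreSym.eq_neg_one_iff q).mp (by rw [legendreSym.mul, hpq_q, h2q]; norm_num)
  have hns_14p_q : ¬ IsSquare ((((p : ℤ) * 14 : ℤ)) : ZMod q) :=
    (legendreSym.eq_neg_one_iff q).mp (by
      rw [show ((p : ℤ) * 14 : ℤ) = p * 2 * 7 by ring, legendreSym.mul, legendreSym.mul, hpq_q, h2q, h7q]; norm_num)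
  have hns_224p_q : ¬ IsSquare (((224 * p : ℤ)) : ZMod q) := by
    rw [show (224 * p : ℤ) = p * 14 * 4 ^ 2 by ring]; exact not_isSquare_mul_sq_zmod h4q hns_14p_q
  have hns_32p_q : ¬ IsSquare (((32 * p : ℤ)) : ZMod q) := by
    rw [show (32 * p : ℤ) = p * 2 * 4 ^ 2 by ring]; exact not_isSquare_mul_sq_zmod h4q hns_2p_q
  have hns_disc_q : ¬ IsSquare ((((-42 * p) ^ 2 - 4 * (448 * p ^ 2) : ℤ)) : ZMod q) := by
    rw [show ((-42 * p) ^ 2 - 4 * (448 * p ^ 2) : ℤ) = -7 * (2 * p) ^ 2 by ring]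
    exact not_isSquare_mul_sq_zmod h2pq ((legendreSym.eq_neg_one_iff q).mp hm7q)
  have hb : (448 * ((q : ℤ) * p) ^ 2 : ℤ) ≠ 0 := by positivity
  ------------------------------------------------------------------ `S ⊆ {1, 7}`
  have hsub : twoIsogenySelmerGroup (-42 * ((q : ℤ) * p)) (448 * ((q : ℤ) * p) ^ 2) ⊆ ({1, 7} : Finset ℤ) := by
    intro d hd
    rw [mem_twoIsogenySelmerGroup_iff hb] at hd
    obtain ⟨hsqf, ⟨d', hdd'⟩, hloc⟩ := hd
    have hd'eq : (448 * ((q : ℤ) * p) ^ 2 : ℤ) / d = d' := by rw [hdd', Int.mul_ediv_cancel_left _ hsqf.ne_zero]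
    rw [hd'eq] at hloc
    obtain ⟨hreal, hpadic⟩ := hloc
    -- negatives die at `ℝ`
    have hdpos : 0 < d := by
      rcases lt_or_gt_of_ne hsqf.ne_zero with hneg | hpos
      · exfalso
        have hbpos : (0 : ℤ) < 448 * ((q : ℤ) * p) ^ 2 := by positivity
        have hd'neg : d' < 0 := by
          by_contra hcon
          nlinarith [mul_nonpos_iff.mpr (Or.inr ⟨hneg.le, le_of_not_gt hcon⟩)]
        have ha : (-42 * ((q : ℤ) * p)) ≤ 0 := by
          have : (0 : ℤ) ≤ (q : ℤ) * p := by positivity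
          linarith
        exact not_isSoluble_real_twoIsogenyQuartic_of_neg hneg hd'neg ha hreal
      · exact hpos
    -- the `q`-classes die at `q`
    have hqd : ¬ (q : ℤ) ∣ d := by
      rintro ⟨e, rfl⟩
      have h1 : e * d' = 448 * q * p ^ 2 := mul_left_cancel₀ hq0 (by linear_combination (-1 : ℤ) * hdd')
      have h3 : (q : ℤ) ∣ e * d' := ⟨448 * p ^ 2, by rw [h1]; ring⟩
      rcases hqZ.dvd_or_dvd h3 with h4 | h4
      · obtain ⟨e₁, rfl⟩ := h4
        exact hqZ.not_unit (hsqf (q : ℤ) ⟨e₁, by ring⟩)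
      · obtain ⟨e', rfl⟩ := h4
        have hm : e * e' = 448 * p ^ 2 := mul_left_cancel₀ hq0 (by linear_combination h1)
        exact not_isSoluble_padic_of_prime_dvd_coeffs (p := q) (c := -42 * p) (by ring) rfl rfl hm hns_disc_q (hpadic q)
    -- `d ∣ 14qp` prime to `q`: `d ∣ 14p`
    have h0 : d ∣ 448 * ((q : ℤ) * p) ^ 2 := ⟨d', hdd'⟩
    have h1 : d ∣ (14 * ((q : ℤ) * p)) ^ 6 := h0.trans ⟨16807 * ((q : ℤ) * p) ^ 4, by ring⟩
    have h14qp : d ∣ 14 * ((q : ℤ) * p) := (hsqf.dvd_pow_iff_dvd (by norm_num)).mp h1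
    have hcopq : IsCoprime d (q : ℤ) := ((hqZ.irreducible.coprime_iff_not_dvd).mpr hqd).symm
    have h14p : d ∣ 14 * (p : ℤ) := by
      have : d ∣ (q : ℤ) * (14 * p) := by rw [show (q : ℤ) * (14 * p) = 14 * (q * p) by ring]; exact h14qp
      exact hcopq.dvd_of_dvd_mul_left this
    by_cases hpd : (p : ℤ) ∣ d
    · -- `d = p·e`, `e ∣ 14`, all four die
      exfalso
      obtain ⟨e, rfl⟩ := hpd
      have he14 : e ∣ 14 := by
        have : (p : ℤ) * e ∣ (p : ℤ) * 14 := by rw [mul_comm (p : ℤ) 14]; exact h14p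
        exact (mul_dvd_mul_iff_left hp0).mp this
      have hepos : 0 < e := pos_of_mul_pos_right hdpos (by positivity)
      have hele : e ≤ 14 := Int.le_of_dvd (by norm_num) he14
      have hd'e : e * d' = 448 * q ^ 2 * p := mul_left_cancel₀ hp0 (by linear_combination (-1 : ℤ) * hdd')
      interval_cases e <;> try omega
      · -- `d = p`: dies at `2` (Fβ⁺-0b)
        exact not_isSoluble_two_class_P_threeModEightPFive hq8 hp8 rfl rfl
          (show d' = (p : ℤ) * (448 * (q : ℤ) ^ 2) by linarith) (hpadic 2)
      · -- `d = 2p`: dies at `q`, `(2p/q) = −1`, `d′ = q²·224p`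
        exact not_isSoluble_padic_of_nonresidue_of_sq_dvd (p := q) (c := -42 * p) (e' := 224 * p) (by ring)
          (show d' = (q : ℤ) ^ 2 * (224 * p) by linarith) hns_2p_q hns_224p_q (hpadic q)
      · -- `d = 7p`: dies at `2` (Fβ⁺-0b)
        exact not_isSoluble_two_class_sevenP_threeModEightPFive hq8 hp8 rfl rfl
          (show d' = (p : ℤ) * (64 * (q : ℤ) ^ 2) by linarith) (hpadic 2)
      · -- `d = 14p`: dies at `q`, `(14p/q) = −1`, `d′ = q²·32p`
        exact not_isSoluble_padic_of_nonresidue_of_sq_dvd (p := q) (c := -42 * p) (e' := 32 * p) (by ring)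
          (show d' = (q : ℤ) ^ 2 * (32 * p) by linarith) hns_14p_q hns_32p_q (hpadic q)
    · -- `d ∣ 14`
      have hcopp : IsCoprime d (p : ℤ) := ((hpZ.irreducible.coprime_iff_not_dvd).mpr hpd).symm
      have hd14 : d ∣ 14 := hcopp.dvd_of_dvd_mul_right h14p
      have hle : d ≤ 14 := Int.le_of_dvd (by norm_num) hd14
      -- `2`, `14` die at `q`: `(2/q) = −1`
      have hne2 : d ≠ 2 := by
        rintro rfl
        exact not_isSoluble_padic_of_nonresidue_of_sq_dvd (p := q) (c := -42 * p) (e' := 224 * p ^ 2) (by ring)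
          (show d' = (q : ℤ) ^ 2 * (224 * p ^ 2) by linarith) hns_2_q hns_224pp_q (hpadic q)
      have hne14 : d ≠ 14 := by
        rintro rfl
        exact not_isSoluble_padic_of_nonresidue_of_sq_dvd (p := q) (c := -42 * p) (e' := 32 * p ^ 2) (by ring)
          (show d' = (q : ℤ) ^ 2 * (32 * p ^ 2) by linarith) hns_14_q hns_32pp_q (hpadic q)
      interval_cases d <;> first | (exfalso; omega) | simp
  exact hsub

/-- **`#S(−42qp, 448q²p²) ≤ 2`** on `q ≡ 3 (8)`, `(q/7) = −1`, `p ≡ 5 (8)`, `(p/q) = +1` (sharp by the kit: `S = {1, 7}`).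
[cite: SilvermanAEC2009, Prop. X.4.9 and Example X.4.10] -/
theorem card_twoIsogenySelmerGroup_twoPrimesTwist_le_two_threeModEightPlusPFive (hq8 : q % 8 = 3) (hq7 : jacobiSym q 7 = -1) (hp8 : p % 8 = 5)
    (hpq : jacobiSym p q = 1) :
    (twoIsogenySelmerGroup (-42 * ((q : ℤ) * p)) (448 * ((q : ℤ) * p) ^ 2)).card ≤ 2 :=
  (Finset.card_le_card (twoIsogenySelmerGroup_twoPrimesTwist_subset_pair_threeModEightPlusPFive hq8 hq7 hp8 hpq)).trans
    Finset.card_le_two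

end SelmerSThreeFivePlus

end Summit.BirchSwinnertonDyer.BirchSwinnertonDyer.Theorems.GoldfeldGoodTwists

end
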